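import Summits.QuantumFields.YangMills.Theorems.UnitScaleTiltFluctuationComparisonRegPrGlobalSlackCanonicalOnChi
import Summits.QuantumFields.YangMills.Theorems.UnitScaleTiltFluctuationComparisonRegPrGlobalSlackCanonicalEndToEndChi
import HarnessLib

/-!
# `UnitScaleTiltFluctuationComparisonRegPrGlobalSlackCanonicalOnChiChi` — STUB (i*)χ OF v5kC FROM THE SIX CHART ROWS AT THE χ-RECORD'S CANONICAL POLYMERISATION, THE THREE
# CONFIGURATION ROWS READ ON PRINT'S χ, BY NAME (crux `FluctuationComparisonRegPrIntL`, stmt-QuantumFields-20520, skeleton v5kC (OWNER ym3-torus-plan g23 C3 pen `birth_v5kC.lean`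
# 3aa24e4fa8fcb956; R-57χ ADD. 6 token map), STUB (i*)χ `stub_smallBlocksSlackOnChiAllChi` (odd `L < 7`, every margin `μ ∈ (0,1)`); width-lever lane B «(R1) print's characteristic
# function χ of [Balaban1985UV3] (47) back — re-derive the small-block case structurally, no numerics», seat ym-ust-19935-r1 g4; core port 5/5)

THE POINT.  ★r1 g2's `GlobalSlackCanonicalOnChi.smallBlocksSlackOnChiAll_of_k1aChartRowsOnChi` (p543293) reads the small-block stub (i)* of v5k BY NAME from `K1aChartRowsOnChi L μ 𝔠 a₀ a₁ a`
— the six chart rows at `dataOfV3 p (canonPolymer p)` with the three configuration-dependent rows (`RemainderSmallΦ`/`CfgSizeΦ`/`CfgCauchyΦ`) asked only at doubly-χ-good data.  The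
registered successor (i*)χ reads the χ-package `PkgAtV3Chi` and the χ-datum `dataOfV3chi p π ≡ dataOfCoreV3 (fun K ↦ (p K).toCore) π`; with the canonical polymerisation and its
producer rows over the data core (`…CanonicalPolymersCore`, `…CoreRows`, `…CoreSizes`) g2's composition reaches it:

* §1 **`K1aChartRowsOnChiChi L μ 𝔠 a₀ a₁ a`** — `K1aChartRowsOnChi` under the token map (`OfV3ChiAt`, `PkgAtV3Chi`, rows at `dataOfV3chi p (canonPolymerCore (toCore ∘ p))` /
  `canonPTCore (toCore ∘ p)`), letters `0 < κ ≤ 𝔠.κ`, `κ₀(32,6) ≤ κ`, `L ≤ M₁` VERBATIM; `k1aChartRowsOnChiChi_of_chartRowsCChi` (the full-window χ-record rows `K1aChartRowsCChi` of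
  `…CanonicalEndToEndChi` + the letter `L ≤ M₁` give the On-χ rows at every margin);
* §2 `slackOnChiAtChi_of_k1aChartRowsOnChiChi` (one block size, one margin) and **`smallBlocksSlackOnChiAllChi_of_k1aChartRowsOnChiChi`** :
  `(∀ odd L, 1 < L < 7, ∀ μ ∈ (0,1), ∀ 𝔠 a₀ a₁ …, ∃ a ∈ (0,1), K1aChartRowsOnChiChi L μ 𝔠 a₀ a₁ a) →` ⟨THE TEXT OF `stub_smallBlocksSlackOnChiAllChi` VERBATIM⟩ — threshold
  `γB ⊓ gammaW ⊓ e^{2(1−p₀)}`, `π := canonPolymerCore (toCore ∘ p)`, `σ := 7`, the `ε₀`-UNIFORM producer constant; producer rows `pintDecompTrivT_canonCore`, `locCover_canonCore`,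
  `locBlockVolume_canonCore` (letter `L ≤ M₁`), `locMatched_canonCore`, `termSizeTrivT_canonCore`; windows from `γ` small; composition ★r1 g2's
  `GlobalSlackLocalToGlobalOn.globalSupRateWSlackOn_of_charts` (datum-generic) and the `Iff.rfl` bridge `printChi_globalSupRateTSlackOn_iff_W`.
UPSHOT FOR v5kC: both analytic χ-stubs — 3⁗χ (`L ≥ 7`, `…CanonicalEndToEndChi`) and (i*)χ (`L < 7`, this file) — again read ONE producer interface BY NAME, the six chart rows at
the χ-record's canonical polymerisation, the small-block one with the three configuration rows restricted to print's χ (the (R1) line's content).  Hypothesis schemas only;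
nothing of [Balaban1985UV3]/[King1986] is asserted; no numerics; registry untouched (`--supports stmt-QuantumFields-20520`).

References: T. Bałaban, CMP 102 (1985) 255–275 [Balaban1985UV3] ((7) p.257, (24)–(25) p.262, (28)–(30) p.263, (33)–(34) p.264, (43)–(47) pp.266–267, (57) p.270);
C. King, CMP 102 (1986) 649–677 [King1986] (Thm 3.4 (3.9) p.656, Prop. 3.6 (3.56) p.662).
-/

set_option autoImplicit false

noncomputable section

namespace Summit.QuantumFields.YangMills.Theorems.GlobalSlackCanonicalOnChi

open scoped BigOperators
open MeasureTheory Filter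
open Literature.MathematicalPhysics.QuantumFieldTheory.Balaban1983to89
open Literature.MathematicalPhysics.QuantumFieldTheory.Balaban1983to89.T3ContinuumYM3Torus
open Literature.MathematicalPhysics.QuantumFieldTheory.Balaban1983to89.T3UnitScaleTilt
open Literature.MathematicalPhysics.QuantumFieldTheory.Balaban1983to89.T3AlphaInputsAC
open Literature.MathematicalPhysics.QuantumFieldTheory.Balaban1983to89.T3AlphaPolymerSocket
open Literature.MathematicalPhysics.QuantumFieldTheory.Balaban1983to89.T3AlphaInputsACTwoRun
open Literature.MathematicalPhysics.QuantumFieldTheory.Balaban1983to89.T3AlphaInputsACTwoRunLevel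
open Literature.MathematicalPhysics.QuantumFieldTheory.Balaban1983to89.B12TreeDecay (kappa₀ K₀ K₀_pos)
open Literature.MathematicalPhysics.QuantumFieldTheory.Balaban1985CMP102
open Literature.MathematicalPhysics.QuantumFieldTheory.Balaban1985CMP102.Setting
open Summit.QuantumFields.Balaban3D.Carriers
open Summit.QuantumFields.Balaban3D.Proofs.Primitives
open Summit.QuantumFields.Balaban3D.Proofs.GroupModelLieC (lieC)
open Summit.QuantumFields.YangMills.Theorems
open Summit.QuantumFields.YangMills.Theorems.GlobalSlackKernelMatching
open Summit.QuantumFields.YangMills.Theorems.GlobalSlackKernelMatchingOn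
open Summit.QuantumFields.YangMills.Theorems.GlobalSlackLocalToGlobalOn
open Summit.QuantumFields.YangMills.Theorems.GlobalSlackCanonicalPolymers

/-! ## §1 The six chart rows at the χ-record's canonical polymerisation, the three configuration rows read on print's χ -/

/-- **THE K1a CHART ROWS ON χ-GOOD DATA AT THE χ-RECORD'S CANONICAL POLYMERISATION** (hypothesis schema, never asserted) — ★r1 g2's `K1aChartRowsOnChi` under the R-57χ token
map: for every regularity threshold `0 < ε₀ ≤ a₀` the three configuration-dependent rows `RemainderSmallΦ`/`CfgSizeΦ`/`CfgCauchyΦ (ℓ ≡ 1)` are asked only at window data that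
are χ-good with margin `μ` for BOTH runs (`PrintChi.ChiGood F γ b₀ p₀ ε₀ μ` — print's `χ_k` of (47)); the located letters `0 < κ ≤ 𝔠.κ`, `κ₀(32,6) ≤ κ`, `L ≤ M₁`, the constants,
the threshold, the coherent family `p : ∀ K, PkgAtV3Chi …` with the given [7]-constants and the three configuration-free rows (`TaylorSplitΦ (canonPTCore (toCore ∘ p))`, K1a
`FlatKernelCauchyΦ`, `KernelSizeΦ` at `dataOfV3chi p (canonPolymerCore (toCore ∘ p))`) are VERBATIM; the chart carriers may depend on `ε₀`.
[cite: Balaban1985UV3, (25) p.262, (28)-(30) p.263, (33)-(34) p.264, (43)-(47) pp.266-267; King1986, Thm 3.4 (3.9) p.656, Prop. 3.6 (3.56) p.662] -/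
def K1aChartRowsOnChiChi (L : ℕ) (μ : ℝ) (𝔠 : AlphaConsts L (suGroupModel 2).N) (a₀ a₁ a : ℝ) : Prop :=
  ∃ (κ C C_E C_R C_s C_B γB : ℝ), 0 < κ ∧ κ ≤ 𝔠.κ ∧ kappa₀ (4 * 2 ^ 3) (2 * 3) ≤ κ ∧ 0 ≤ C ∧ 0 ≤ C_E ∧ 0 ≤ C_R ∧ 0 ≤ C_s ∧ 0 ≤ C_B ∧ 0 < γB ∧
    L ≤ 𝔠.M₁ ∧
    ∀ (F : T3Family) (γ : ℝ) (hF : F.L = L) (hγ : 0 < γ), γ ≤ γB → ∀ (hγ1 : γ ≤ (min (hF ▸ 𝔠).gamma0 1) ^ 2),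
      AlphaInputsT3AC.OfV3ChiAt F (hF ▸ 𝔠) a₀ a₁ →
        ∃ (p : ∀ K, AlphaInputsT3AC.PkgAtV3Chi F (hF ▸ 𝔠) γ hγ hγ1 K), (∀ K, (p K).a₀ = a₀ ∧ (p K).a₁ = a₁) ∧
          ∀ ε₀ : ℝ, 0 < ε₀ → ε₀ ≤ a₀ →
          ∃ (Φ : ChartFam ↥(lieC (suGroupModel 2)) F) (e : VacFam F) (B : CfgFam ↥(lieC (suGroupModel 2)) F) (R : RemFam F),
            TaylorSplitΦ (canonPTCore fun K => (p K).toCore) Φ e B R ∧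
            FlatKernelCauchyΦ (AlphaInputsT3AC.dataOfV3chi p (canonPolymerCore fun K => (p K).toCore)) Φ κ a C ∧
            KernelSizeΦ (AlphaInputsT3AC.dataOfV3chi p (canonPolymerCore fun K => (p K).toCore)) Φ κ C_E ∧
            RemainderSmallΦOn (fun K n h V => PrintChi.ChiGood F γ (hF ▸ 𝔠).b₀ (hF ▸ 𝔠).p₀ ε₀ μ (n := n) (K := K) h V)
              (AlphaInputsT3AC.dataOfV3chi p (canonPolymerCore fun K => (p K).toCore)) R (hF ▸ 𝔠).b₀ (hF ▸ 𝔠).p₀ κ C_R ∧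
            CfgSizeΦOn (fun K n h V => PrintChi.ChiGood F γ (hF ▸ 𝔠).b₀ (hF ▸ 𝔠).p₀ ε₀ μ (n := n) (K := K) h V)
              (AlphaInputsT3AC.dataOfV3chi p (canonPolymerCore fun K => (p K).toCore)) B (hF ▸ 𝔠).b₀ (hF ▸ 𝔠).p₀ C_s ∧
            CfgCauchyΦOn (fun K n h V => PrintChi.ChiGood F γ (hF ▸ 𝔠).b₀ (hF ▸ 𝔠).p₀ ε₀ μ (n := n) (K := K) h V)
              (AlphaInputsT3AC.dataOfV3chi p (canonPolymerCore fun K => (p K).toCore)) B (hF ▸ 𝔠).b₀ (hF ▸ 𝔠).p₀ a C_B fun _ => 1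

/-- **THE FULL-WINDOW χ-RECORD ROWS (AND THE LETTER `L ≤ M₁`) GIVE THE On-χ ROWS AT EVERY MARGIN** (`…On_of_full`; the carriers do not depend on `ε₀`). [cite: Balaban1985UV3, (47) p.267] -/
theorem k1aChartRowsOnChiChi_of_chartRowsCChi {L : ℕ} (μ : ℝ) {𝔠 : AlphaConsts L (suGroupModel 2).N} {a₀ a₁ a : ℝ} (hM : L ≤ 𝔠.M₁)
    (h : K1aChartRowsCChi L 𝔠 a₀ a₁ a) : K1aChartRowsOnChiChi L μ 𝔠 a₀ a₁ a := by
  obtain ⟨κ, C, C_E, C_R, C_s, C_B, γB, hκ0, hκle, hκ₀, hC, hCE, hCR, hCs, hCB, hγB, hall⟩ := h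
  refine ⟨κ, C, C_E, C_R, C_s, C_B, γB, hκ0, hκle, hκ₀, hC, hCE, hCR, hCs, hCB, hγB, hM, fun F γ hF hγ hγle hγ1 hOf => ?_⟩
  obtain ⟨p, hp, Φ, e, B, R, hT, hK, hE, hR, hS, hBC⟩ := hall F γ hF hγ hγle hγ1 hOf
  exact ⟨p, hp, fun ε₀ _ _ => ⟨Φ, e, B, R, hT, hK, hE, remainderSmallΦOn_of_full _ hR, cfgSizeΦOn_of_full _ hS, cfgCauchyΦOn_of_full _ hBC⟩⟩

/-! ## §2 The registered stub (i*)χ from the On-χ rows, by name -/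

/-- **ONE BLOCK SIZE, ONE MARGIN**: if at block size `L` and margin `μ` every constants record with [7]-constants has a rate exponent `0 < a < 1` with
`K1aChartRowsOnChiChi L μ 𝔠 a₀ a₁ a`, then the (i*)χ-clause AT `(L, μ)` holds — threshold `γB ⊓ gammaW L 𝔠 C_s C_B ⊓ e^{2(1−p₀)}`, `π := canonPolymerCore (toCore ∘ p)`, `σ := 7`, and the
`ε₀`-UNIFORM constant `max(C′,0)·(C_T + C₁/(1 − L^{a−1}) + C₁/(1 − L⁻¹))` (`C′ = max 1 K₀(32,6)`, `C_T = max newConst (oldConst·L⁴·e^{κL³})`, `C₁ = 5(C_s²C + 6C_sC_BC_E) + 2C_R`); for each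
`ε₀` the On-χ rows feed `GlobalSlackLocalToGlobalOn.globalSupRateWSlackOn_of_charts` over the five CORE producer theorems at `q := toCore ∘ p` and the three coupling windows from `γ`
small (g2's `slackOnChiAt_of_k1aChartRowsOnChi`, proof verbatim under the token map). [cite: Balaban1985UV3, (7) p.257, (43)-(47) pp.266-267, (57) p.270; King1986, Thm 3.4 (3.9) p.656, Prop. 3.6 p.662] -/
theorem slackOnChiAtChi_of_k1aChartRowsOnChiChi (L : ℕ) (μ : ℝ)
    (h : ∀ (𝔠 : AlphaConsts L (suGroupModel 2).N) (a₀ a₁ : ℝ),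
      0 < a₀ → 0 < a₁ → 𝔠.B₃ * a₁ ≤ a₀ → ∃ a : ℝ, 0 < a ∧ a < 1 ∧ K1aChartRowsOnChiChi L μ 𝔠 a₀ a₁ a) :
    ∀ (𝔠 : Summit.QuantumFields.Balaban3D.Proofs.Primitives.AlphaConsts L (Summit.QuantumFields.Balaban3D.Carriers.suGroupModel 2).N)
      (a₀ a₁ : ℝ), 0 < a₀ → 0 < a₁ → 𝔠.B₃ * a₁ ≤ a₀ →
      ∃ a : ℝ, 0 < a ∧ ∃ γB : ℝ, 0 < γB ∧ ∀ (F : T3Family) (γ : ℝ) (hF : F.L = L) (hγ : 0 < γ), γ ≤ γB →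
        ∀ (hγ1 : γ ≤ (min (hF ▸ 𝔠).gamma0 1) ^ 2),
          Summit.QuantumFields.YangMills.Theorems.AlphaInputsT3AC.OfV3ChiAt F (hF ▸ 𝔠) a₀ a₁ →
          ∃ (p : ∀ K, Summit.QuantumFields.YangMills.Theorems.AlphaInputsT3AC.PkgAtV3Chi F (hF ▸ 𝔠) γ hγ hγ1 K),
            (∀ K, (p K).a₀ = a₀ ∧ (p K).a₁ = a₁) ∧
            ∃ (π : Summit.QuantumFields.YangMills.Theorems.AlphaInputsT3AC.PolymerT3 F) (σ : ℕ) (C : ℝ), 7 ≤ σ ∧ 0 ≤ C ∧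
              ∀ ε₀ : ℝ, 0 < ε₀ → ε₀ ≤ a₀ →
                Summit.QuantumFields.YangMills.Theorems.PrintChi.GlobalSupRateTSlackOn
                  (fun K n h V => Summit.QuantumFields.YangMills.Theorems.PrintChi.ChiGood F γ (hF ▸ 𝔠).b₀ (hF ▸ 𝔠).p₀ ε₀ μ (n := n) (K := K) h V)
                  (Summit.QuantumFields.YangMills.Theorems.AlphaInputsT3AC.dataOfV3chi p π) (hF ▸ 𝔠).b₀ (hF ▸ 𝔠).p₀ a σ C := by
  intro 𝔠 a₀ a₁ ha0 ha1 hw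
  obtain ⟨a, ha, ha1', κ, C, C_E, C_R, C_s, C_B, γB, hκ0, hκle, hκ₀, hC, hCE, hCR, hCs, hCB, hγB, hM, hall⟩ := h 𝔠 a₀ a₁ ha0 ha1 hw
  refine ⟨a, ha, min γB (min (gammaW L 𝔠 C_s C_B) (Real.exp (2 * (1 - 𝔠.p₀)))),
    lt_min hγB (lt_min (gammaW_pos L 𝔠 C_s C_B) (Real.exp_pos _)), fun F γ hF hγ hγle hγ1 hOf => ?_⟩
  subst hF
  have hγB' : γ ≤ γB := hγle.trans (min_le_left _ _)
  have hW : γ ≤ gammaW F.L 𝔠 C_s C_B := hγle.trans ((min_le_right _ _).trans (min_le_left _ _))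
  have hγe : Real.sqrt γ ≤ Real.exp (1 - 𝔠.p₀) :=
    sqrt_le_exp_of_le (hγle.trans ((min_le_right _ _).trans (min_le_right _ _)))
  have h0 : γ ≤ gammaθ 𝔠.b₀ 𝔠.p₀ (1 / max 1 (C_s + C_B)) := hW.trans (min_le_left _ _)
  have h1 : γ ≤ gammaθ 𝔠.b₀ (𝔠.p₀ + 𝔠.r₀) (𝔠.ρ / (4 * max 1 𝔠.cB)) := hW.trans ((min_le_right _ _).trans (min_le_left _ _))
  have h2 : γ ≤ gammaθ 𝔠.b₀ 𝔠.p₀ (1 / (2 * (8 * ((F.L : ℝ) + 1) ^ 2 * 𝔠.B₃ * 𝔠.Zfull))) := hW.trans ((min_le_right _ _).trans (min_le_right _ _))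
  have hγ1' : γ ≤ 1 := hγ1.trans (sq_min_one_le _ 𝔠.gamma0_pos)
  have hwin : ∀ n, (C_s + C_B) * θBal F.L γ 𝔠.b₀ 𝔠.p₀ n ≤ 1 := fun n => window_sum_le_one F.hL.2.le 𝔠.b₀_pos 𝔠.p₀_pos hγ hγ1' h0 n
  obtain ⟨p, hp, hrows⟩ := hall F γ rfl hγ hγB' hγ1 hOf
  -- the projected family of data cores
  set q : ∀ K, AlphaInputsT3AC.PkgCoreV3 F 𝔠 γ hγ hγ1 K := fun K => (p K).toCore
  have hw1 := fun K k hk => window_jet (hγ := hγ) (hγ1 := hγ1) h1 K k hk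
  have hw2 := fun K k hk => window_oldSlice (hγ := hγ) (hγ1 := hγ1) h2 K k hk
  -- the five producer rows for the canonical polymerisation over the core and their constants
  have hdec := pintDecompTrivT_canonCore q
  have hLC := locCover_canonCore q hκ0.le hκ₀
  have hBV := locBlockVolume_canonCore q hM
  have hLM := locMatched_canonCore q
  have hTS := termSizeTrivT_canonCore q hκ0 hκle hw1 hw2
  have hCT : 0 ≤ max (newConst 𝔠) (oldConst 𝔠 * (F.L : ℝ) ^ 4 * Real.exp (κ * (F.L : ℝ) ^ 3)) := le_max_of_le_left (newConst_nonneg 𝔠)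
  have hC₁ : 0 ≤ 5 * (C_s ^ 2 * C + 6 * C_s * C_B * C_E) + 2 * C_R := by positivity
  refine ⟨p, hp, canonPolymerCore q, 7, _, le_rfl, producerConst_nonneg F (C' := max 1 (K₀ (4 * 2 ^ 3) (2 * 3))) ha1' hC₁ hCT, fun ε₀ hε hεa => ?_⟩
  obtain ⟨Φ, e, B, R, hT, hK, hE, hR, hS, hBC⟩ := hrows ε₀ hε hεa
  exact (printChi_globalSupRateTSlackOn_iff_W _ _ _ _ _ _ _).2
    (globalSupRateWSlackOn_of_charts _ hγ hγ1' hγe 𝔠.b₀_pos 𝔠.p₀_pos.le ha ha1' hC hCE hCR hCs hCB hCT hwin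
      hdec hLC hBV hLM hTS hT hK hE hR hS hBC)

/-- **THE REGISTERED STUB (i*)χ `stub_smallBlocksSlackOnChiAllChi` FROM THE SIX CHART ROWS AT THE χ-RECORD'S CANONICAL POLYMERISATION READ ON PRINT'S χ, BY NAME.**  If for every odd
`1 < L < 7`, every margin `μ ∈ (0,1)`, every constants record and [7]-constants there is a rate exponent `0 < a < 1` with `K1aChartRowsOnChiChi L μ 𝔠 a₀ a₁ a`, then the text of
`stub_smallBlocksSlackOnChiAllChi` (skeleton v5kC of stmt-QuantumFields-20520, OWNER C3 pen) holds VERBATIM (`slackOnChiAtChi_of_k1aChartRowsOnChiChi` at each `(L, μ)`).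
[cite: Balaban1985UV3, (47) p.267, (57) p.270; King1986, Thm 3.4 (3.9) p.656, Prop. 3.6 p.662] -/
theorem smallBlocksSlackOnChiAllChi_of_k1aChartRowsOnChiChi
    (h : ∀ (L : ℕ), Odd L → 1 < L → L < 7 → ∀ (μ : ℝ), 0 < μ → μ < 1 → ∀ (𝔠 : AlphaConsts L (suGroupModel 2).N) (a₀ a₁ : ℝ),
      0 < a₀ → 0 < a₁ → 𝔠.B₃ * a₁ ≤ a₀ → ∃ a : ℝ, 0 < a ∧ a < 1 ∧ K1aChartRowsOnChiChi L μ 𝔠 a₀ a₁ a) :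
    ∀ (L : ℕ), Odd L → 1 < L → L < 7 → ∀ (μ : ℝ), 0 < μ → μ < 1 →
      ∀ (𝔠 : Summit.QuantumFields.Balaban3D.Proofs.Primitives.AlphaConsts L (Summit.QuantumFields.Balaban3D.Carriers.suGroupModel 2).N)
        (a₀ a₁ : ℝ), 0 < a₀ → 0 < a₁ → 𝔠.B₃ * a₁ ≤ a₀ →
        ∃ a : ℝ, 0 < a ∧ ∃ γB : ℝ, 0 < γB ∧ ∀ (F : T3Family) (γ : ℝ) (hF : F.L = L) (hγ : 0 < γ), γ ≤ γB →
          ∀ (hγ1 : γ ≤ (min (hF ▸ 𝔠).gamma0 1) ^ 2),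
            Summit.QuantumFields.YangMills.Theorems.AlphaInputsT3AC.OfV3ChiAt F (hF ▸ 𝔠) a₀ a₁ →
            ∃ (p : ∀ K, Summit.QuantumFields.YangMills.Theorems.AlphaInputsT3AC.PkgAtV3Chi F (hF ▸ 𝔠) γ hγ hγ1 K),
              (∀ K, (p K).a₀ = a₀ ∧ (p K).a₁ = a₁) ∧
              ∃ (π : Summit.QuantumFields.YangMills.Theorems.AlphaInputsT3AC.PolymerT3 F) (σ : ℕ) (C : ℝ), 7 ≤ σ ∧ 0 ≤ C ∧
                ∀ ε₀ : ℝ, 0 < ε₀ → ε₀ ≤ a₀ →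
                  Summit.QuantumFields.YangMills.Theorems.PrintChi.GlobalSupRateTSlackOn
                  (fun K n h V => Summit.QuantumFields.YangMills.Theorems.PrintChi.ChiGood F γ (hF ▸ 𝔠).b₀ (hF ▸ 𝔠).p₀ ε₀ μ (n := n) (K := K) h V)
                    (Summit.QuantumFields.YangMills.Theorems.AlphaInputsT3AC.dataOfV3chi p π) (hF ▸ 𝔠).b₀ (hF ▸ 𝔠).p₀ a σ C :=
  fun L hLo hL1 hL7 μ hμ0 hμ1 => slackOnChiAtChi_of_k1aChartRowsOnChiChi L μ (h L hLo hL1 hL7 μ hμ0 hμ1)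

/-! ## §3 The corollary from the full-window χ-record rows under the letter `L ≤ M₁` -/

/-- **(i*)χ FROM THE FULL-WINDOW χ-RECORD ROWS AT `L ∈ {3,5}`** (the «if 3⁗χ's producer runs at every block size» reading; letter `L ≤ M₁`): if for every odd `1 < L < 7`, every
constants record with `L ≤ 𝔠.M₁` and [7]-constants there is `0 < a < 1` with the FULL-window `K1aChartRowsCChi L 𝔠 a₀ a₁ a`, then `stub_smallBlocksSlackOnChiAllChi` holds at every
margin (`k1aChartRowsOnChiChi_of_chartRowsCChi`).  Recorded for honesty: the window edge band (FINDING #44/#56) is why the full-window configuration rows are NOT expected at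
`L ∈ {3,5}`; the On-χ rows of §1 are the (R1) line's content. [cite: Balaban1985UV3, (47) p.267; King1986, Thm 3.4 (3.9) p.656] -/
theorem smallBlocksSlackOnChiAllChi_of_k1aChartRowsCChi
    (h : ∀ (L : ℕ), Odd L → 1 < L → L < 7 → ∀ (𝔠 : AlphaConsts L (suGroupModel 2).N) (a₀ a₁ : ℝ),
      0 < a₀ → 0 < a₁ → 𝔠.B₃ * a₁ ≤ a₀ → L ≤ 𝔠.M₁ ∧ ∃ a : ℝ, 0 < a ∧ a < 1 ∧ K1aChartRowsCChi L 𝔠 a₀ a₁ a) :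
    ∀ (L : ℕ), Odd L → 1 < L → L < 7 → ∀ (μ : ℝ), 0 < μ → μ < 1 →
      ∀ (𝔠 : Summit.QuantumFields.Balaban3D.Proofs.Primitives.AlphaConsts L (Summit.QuantumFields.Balaban3D.Carriers.suGroupModel 2).N)
        (a₀ a₁ : ℝ), 0 < a₀ → 0 < a₁ → 𝔠.B₃ * a₁ ≤ a₀ →
        ∃ a : ℝ, 0 < a ∧ ∃ γB : ℝ, 0 < γB ∧ ∀ (F : T3Family) (γ : ℝ) (hF : F.L = L) (hγ : 0 < γ), γ ≤ γB →
          ∀ (hγ1 : γ ≤ (min (hF ▸ 𝔠).gamma0 1) ^ 2),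
            Summit.QuantumFields.YangMills.Theorems.AlphaInputsT3AC.OfV3ChiAt F (hF ▸ 𝔠) a₀ a₁ →
            ∃ (p : ∀ K, Summit.QuantumFields.YangMills.Theorems.AlphaInputsT3AC.PkgAtV3Chi F (hF ▸ 𝔠) γ hγ hγ1 K),
              (∀ K, (p K).a₀ = a₀ ∧ (p K).a₁ = a₁) ∧
              ∃ (π : Summit.QuantumFields.YangMills.Theorems.AlphaInputsT3AC.PolymerT3 F) (σ : ℕ) (C : ℝ), 7 ≤ σ ∧ 0 ≤ C ∧
                ∀ ε₀ : ℝ, 0 < ε₀ → ε₀ ≤ a₀ →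
                  Summit.QuantumFields.YangMills.Theorems.PrintChi.GlobalSupRateTSlackOn
                  (fun K n h V => Summit.QuantumFields.YangMills.Theorems.PrintChi.ChiGood F γ (hF ▸ 𝔠).b₀ (hF ▸ 𝔠).p₀ ε₀ μ (n := n) (K := K) h V)
                    (Summit.QuantumFields.YangMills.Theorems.AlphaInputsT3AC.dataOfV3chi p π) (hF ▸ 𝔠).b₀ (hF ▸ 𝔠).p₀ a σ C :=
  smallBlocksSlackOnChiAllChi_of_k1aChartRowsOnChiChi fun L hLo hL1 hL7 μ _ _ 𝔠 a₀ a₁ ha0 ha1 hw => by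
    obtain ⟨hM, a, ha, ha1', hc⟩ := h L hLo hL1 hL7 𝔠 a₀ a₁ ha0 ha1 hw
    exact ⟨a, ha, ha1', k1aChartRowsOnChiChi_of_chartRowsCChi μ hM hc⟩

end Summit.QuantumFields.YangMills.Theorems.GlobalSlackCanonicalOnChi

end
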